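import Literature.NumberTheory.LFunctions.ConreyIwaniec2002ShiftedConvolutionOf
import Literature.NumberTheory.LFunctions.ConreyIwaniec2002SigmaGenus
import Literature.NumberTheory.LFunctions.ConreyIwaniec2002CircleMethodAssembly
import Literature.NumberTheory.LFunctions.ConreyIwaniec2002BesselAmplitude
import Literature.NumberTheory.LFunctions.ConreyIwaniec2002HeckeVoronoi
import HarnessLib

/-!
# Conrey–Iwaniec (2002) Theorems 4.3/4.4 for `λ_ψ` from the open stubs, with S3e (and S3b3, S3c1,
# V2) discharged by name — integration glue for the line `theta-circle-method`

B. Conrey, H. Iwaniec, *Spacing of zeros of Hecke L-functions and the class number problem*,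
Acta Arith. 103 (2002) 259–312, §4 Theorems 4.3/4.4 [held text `paper:arxiv-math_0111012`].
Cell `landau-siegel/ls-inputs`, SKELETON S3 (v7 e6c8d1cb86b50532); theorem-only glue.

The tree's joint-sufficiency theorem `shifted_convolution_of_stubs` (p649043,
`ConreyIwaniec2002ShiftedConvolutionOf.lean`) derives the registered S3 `stub_shifted_convolution`
from the open stubs S3b3, S3c1, S3c2, S3d and the two halves S3e1/S3e2 of S3e, using the latter
ONLY through `sigma_genus_of_stubs he1 he2 : <S3e>`. The registered S3e `stub_sigma_genus` is now
a tree theorem (`sigma_genus`, p651442, `ConreyIwaniec2002SigmaGenus.lean`), so: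

* `shifted_convolution_of_stubs'` — the same composition with S3e discharged by `sigma_genus`
  (hypotheses: S3b3, S3c1, S3c2, S3d, texts verbatim; the proof is p649043's, one term replaced);
* `shifted_convolution_of_besselKernel_thetaOmega` — with the landed S3b3
  (`CircleMethod.circle_assembly`, p650813), S3c1 (`bessel_amplitude`, p651061) and V2
  (`hecke_voronoi`, p650035, through `voronoi_theta_of_omega_hecke`) plugged in:
  **S3 (Theorems 4.3/4.4 for `λ_ψ`) = KERNEL MODULO {S3c2 `stub_bessel_kernel_of_amplitude`,
  V1 `stub_theta_omega`}**, hypotheses stated as the registered texts verbatim.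

«The programme SEARCHES and TYPES; no claim about Landau–Siegel zeros, Theorems 1–2 of
arXiv:2211.02515 or a repaired Margin232 until a kernel theorem says so.» Nothing here proves
Proposition 6.4.
-/

noncomputable section

open scoped NumberField FourierTransform
open Complex MeasureTheory

namespace Literature.NumberTheory.LFunctions

namespace ConreyIwaniec2002

open NumberField Literature.NumberTheory.LFunctions.NumberField
open Literature.Analysis.FunctionSpaces (besselJ)
open Literature.NumberTheory.Sieve (ramanujanSum)

/-- An odd Dirichlet character is not trivial. [folklore] -/
private theorem ne_one_of_odd' {q : ℕ} [NeZero q] {χ : DirichletCharacter ℂ q} (hodd : χ.Odd) :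
    χ ≠ 1 := by
  rintro rfl
  have h : ((1 : DirichletCharacter ℂ q) (-1) : ℂ) = -1 := hodd
  rw [MulChar.one_apply (isUnit_one.neg)] at h
  norm_num at h

/-- **THEOREMS 4.3/4.4 FOR `λ_ψ` FROM THE OPEN STUBS S3b3, S3c1, S3c2, S3d — with S3e DISCHARGED**
(`sigma_genus`, p651442): the tree's `shifted_convolution_of_stubs` (p649043) verbatim except that
the term `sigma_genus_of_stubs he1 he2 …` is replaced by the landed `sigma_genus …`, so the
hypotheses `he1` (S3e1) / `he2` (S3e2) disappear; the conclusion is VERBATIM the registered S3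
`stub_shifted_convolution` of SKELETON P64. [cite: ConreyIwaniec2002, Theorem 4.3 (4.25), Theorem 4.4 (4.26)] -/
theorem shifted_convolution_of_stubs'
    (hb3 :
    ∀ (c₁ K₀ : ℝ), 0 < c₁ → 0 < K₀ → BumpFourierDecay c₁ → ZeroDetectorIdentity →
      IncompleteKloostermanBound K₀ → ∃ c₀ : ℝ, 0 < c₀ ∧ CircleMethodBound c₀)
    (hc1 : ∃ C_W : ℝ, 0 < C_W ∧ BesselJZeroAmplitude C_W)
    (hc2 :
    ∀ C_W : ℝ, 0 < C_W → BesselJZeroAmplitude C_W →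
      ∃ B₀ : ℝ, 1 ≤ B₀ ∧ ∀ (q : ℕ), 1 ≤ q → ∀ r : ℕ → ℕ, (∀ c : ℕ, 1 ≤ r c ∧ r c ≤ q) →
        KernelFourierBound q (B₀ * (q : ℝ) ^ (3 / 2 : ℝ)) (ciBesselKernel r))
    (hd :
    ∀ (q : ℕ) [NeZero q], 4 < q → Odd q → ∀ χ : DirichletCharacter ℂ q,
      χ.IsPrimitive → χ.IsQuadratic → χ.Odd →
        ∀ (K : Type) [Field K] [NumberField K],
          Module.finrank ℚ K = 2 → NumberField.discr K = -(q : ℤ) →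
            ∀ (ψ : ClassGroup (𝓞 K) →* ℂˣ),
              ∃ (u : ℕ → ℤ → ℂ) (φ : ℕ → ℕ → ℂ),
                IsVoronoiDatum (2 * Real.pi + Real.sqrt q * ‖χ.LFunction 1‖)
                  (twistCount K (classGroupCharIdealHom ψ))
                  (ciBesselKernel fun c ↦ q / Nat.gcd c q)
                  (voronoiMainCoeff q ‖χ.LFunction 1‖ ψ) u φ
                  (fun c m ↦ -(((((q / Nat.gcd c q : ℕ) : ZMod c)⁻¹).val : ℤ) * m))) :
    ∃ c : ℝ, 0 < c ∧
      ∀ (q : ℕ) [NeZero q], 4 < q → Odd q → ∀ χ : DirichletCharacter ℂ q,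
        χ.IsPrimitive → χ.IsQuadratic → χ.Odd →
          ∀ (K : Type) [Field K] [NumberField K],
            Module.finrank ℚ K = 2 → NumberField.discr K = -(q : ℤ) →
              ∀ (ψ : ClassGroup (𝓞 K) →* ℂˣ),
                ∃ σ : ℕ → ℝ, IsCISigma q ‖χ.LFunction 1‖ σ ∧
                  ShiftedConvolutionBound (twistCount K (classGroupCharIdealHom ψ)) σ
                    (c * (q : ℝ) ^ (6 : ℕ)) := by
  obtain ⟨c₁, hc₁, hF⟩ := bump_fourier
  obtain ⟨K₀, hK₀, hK⟩ := incomplete_kloosterman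
  obtain ⟨c₀, hc₀, hCM⟩ := hb3 c₁ K₀ hc₁ hK₀ hF zeroDetectorIdentity_holds hK
  obtain ⟨C_W, hCW, hW⟩ := hc1
  obtain ⟨B₀, hB₀, hKer⟩ := hc2 C_W hCW hW
  obtain ⟨c, hc, habs⟩ := circleMethod_absorb_constants c₀ B₀ hc₀ hB₀
  refine ⟨c, hc, ?_⟩
  intro q _ hq hodd χ hprim hquad hoddχ K _ _ h2 hdisc ψ
  set ℓ : ℝ := ‖χ.LFunction 1‖ with hℓ
  set lam : ℕ → ℂ := twistCount K (classGroupCharIdealHom ψ) with hlam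
  set p : ℕ → ℝ := voronoiMainCoeff q ℓ ψ with hp
  set rr : ℕ → ℕ := fun c ↦ q / Nat.gcd c q with hrr
  -- S3d: the summation datum; S3e: the main-term coefficients are admissible
  obtain ⟨u, φ, hV⟩ := hd q hq hodd χ hprim hquad hoddχ K h2 hdisc ψ
  refine ⟨ciSigma p, sigma_genus q hq hodd χ hprim hquad hoddχ K h2 hdisc ψ, ?_⟩
  intro X hX g₁ g₂ hg₁ hg₂ h hh
  -- numerics
  have hq5 : (5 : ℝ) ≤ q := by exact_mod_cast hq
  have hq2 : 2 ≤ q := by omega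
  have hq1 : 1 ≤ q := by omega
  have hℓ0 : 0 ≤ ℓ := norm_nonneg _
  have hℓlog : ℓ ≤ Real.log q := DirichletAbel.norm_LFunction_one_le_log χ (ne_one_of_odd' hoddχ)
  have hA : 1 ≤ 2 * Real.pi + Real.sqrt q * ℓ := by
    have : 0 ≤ Real.sqrt q * ℓ := by positivity
    linarith [Real.pi_gt_three]
  have hB : 1 ≤ B₀ * (q : ℝ) ^ (3 / 2 : ℝ) := by
    have h1 : (1 : ℝ) ≤ (q : ℝ) ^ (3 / 2 : ℝ) := Real.one_le_rpow (by linarith) (by norm_num)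
    nlinarith
  -- S3c: (4.5) for the Bessel kernels with `r = q/(c,q)`
  have hrr1 : ∀ c : ℕ, 1 ≤ rr c ∧ rr c ≤ q := by
    intro c
    refine ⟨?_, Nat.div_le_self q _⟩
    have hg : 0 < Nat.gcd c q := Nat.gcd_pos_of_pos_right c (by omega)
    exact (Nat.one_le_div_iff hg).mpr (Nat.le_of_dvd (by omega) (Nat.gcd_dvd_right c q))
  have hK := hKer q hq1 rr hrr1
  -- S3b: the circle method
  have hmain := hCM q hq2 _ _ hA hB lam (ciBesselKernel rr) p u φ _ hV hK X hX g₁ g₂ hg₁ hg₂ h hh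
  -- S3f: absorption
  have hfin := habs q X ℓ hq5 hX hℓ0 hℓlog
  have hτ : (0 : ℝ) ≤ (Nat.divisors h).card := Nat.cast_nonneg _
  calc ‖(∑ n ∈ Finset.Icc 1 ⌊2 * X⌋₊,
            lam (n + h) * starRingEnd ℂ (lam n) * g₁ ((n : ℝ) + h) * g₂ n) -
          (ciSigma p h : ℂ) * ∫ x : ℝ, g₁ (x + h) * g₂ x‖
      ≤ c₀ * (Nat.divisors h).card * (2 * Real.pi + Real.sqrt q * ℓ) ^ 2 *
          (X / Real.sqrt (q * X) +
            q * (B₀ * (q : ℝ) ^ (3 / 2 : ℝ)) ^ 2 * ((q : ℝ) * X) ^ (3 / 4 : ℝ) *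
              (1 + Real.log (q * X)) ^ 2) := hmain
    _ = (Nat.divisors h).card * (c₀ * (2 * Real.pi + Real.sqrt q * ℓ) ^ 2 *
          (X / Real.sqrt (q * X) +
            q * (B₀ * (q : ℝ) ^ (3 / 2 : ℝ)) ^ 2 * ((q : ℝ) * X) ^ (3 / 4 : ℝ) *
              (1 + Real.log (q * X)) ^ 2)) := by ring
    _ ≤ (Nat.divisors h).card * (c * (q : ℝ) ^ (6 : ℕ) * X ^ (3 / 4 : ℝ) * Real.log (3 * X) ^ 2) :=
        mul_le_mul_of_nonneg_left hfin hτ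
    _ = c * (q : ℝ) ^ (6 : ℕ) * (Nat.divisors h).card * X ^ (3 / 4 : ℝ) * Real.log (3 * X) ^ 2 := by
        ring



/-- **S3 = KERNEL MODULO {S3c2, V1}**: Theorems 4.3/4.4 for `λ_ψ` (the registered S3
`stub_shifted_convolution`, text verbatim) from the registered S3c2 `stub_bessel_kernel_of_amplitude`
and V1 `stub_theta_omega` (texts verbatim), with S3a, S3b1–S3b3, S3c1, S3e, S3f, V2, V3 all tree
theorems by name. [cite: ConreyIwaniec2002, Theorem 4.3 (4.25), Theorem 4.4 (4.26)] -/
theorem shifted_convolution_of_besselKernel_thetaOmega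
    (hc2 :
    ∀ C_W : ℝ, 0 < C_W → BesselJZeroAmplitude C_W →
      ∃ B₀ : ℝ, 1 ≤ B₀ ∧ ∀ (q : ℕ), 1 ≤ q → ∀ r : ℕ → ℕ, (∀ c : ℕ, 1 ≤ r c ∧ r c ≤ q) →
        KernelFourierBound q (B₀ * (q : ℝ) ^ (3 / 2 : ℝ)) (ciBesselKernel r))
    (hV1 :
    ∀ (q : ℕ) [NeZero q], 4 < q → Odd q → ∀ χ : DirichletCharacter ℂ q,
      χ.IsPrimitive → χ.IsQuadratic → χ.Odd →
        ∀ (K : Type) [Field K] [NumberField K],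
          Module.finrank ℚ K = 2 → NumberField.discr K = -(q : ℤ) →
            ∀ (ψ : ClassGroup (𝓞 K) →* ℂˣ) (c : ℕ), 1 ≤ c →
              ∃ ψ' : ClassGroup (𝓞 K) →* ℂˣ, IsGenusCharFor (ψ' * ψ⁻¹) (Nat.gcd c q) ∧
                ∀ a abar : ℤ, a * abar ≡ 1 [ZMOD c] →
                  ∃ η : ℂ, ‖η‖ = 1 ∧
                    IsOmegaRelated ((c : ℝ) * Real.sqrt (q / Nat.gcd c q : ℕ)) η
                      (twistCount K (classGroupCharIdealHom ψ))
                      (twistCount K (classGroupCharIdealHom ψ'))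
                      (thetaConst K ψ) (thetaConst K ψ')
                      ((a : ℝ) / c)
                      (-((abar * ((((q / Nat.gcd c q : ℕ) : ZMod c)⁻¹).val : ℤ) : ℤ) : ℝ) / c)) :
    ∃ c : ℝ, 0 < c ∧
      ∀ (q : ℕ) [NeZero q], 4 < q → Odd q → ∀ χ : DirichletCharacter ℂ q,
        χ.IsPrimitive → χ.IsQuadratic → χ.Odd →
          ∀ (K : Type) [Field K] [NumberField K],
            Module.finrank ℚ K = 2 → NumberField.discr K = -(q : ℤ) →
              ∀ (ψ : ClassGroup (𝓞 K) →* ℂˣ),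
                ∃ σ : ℕ → ℝ, IsCISigma q ‖χ.LFunction 1‖ σ ∧
                  ShiftedConvolutionBound (twistCount K (classGroupCharIdealHom ψ)) σ
                    (c * (q : ℝ) ^ (6 : ℕ)) :=
  shifted_convolution_of_stubs' CircleMethod.circle_assembly bessel_amplitude hc2
    (voronoi_theta_of_omega_hecke hV1 hecke_voronoi)

end ConreyIwaniec2002

end Literature.NumberTheory.LFunctions

end
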